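/-
Copyright (c) 2026. Released under Apache 2.0 license as described in the file LICENSE.
-/
import Literature.NumberTheory.Automorphic.RealMatrixGroups
import Literature.NumberTheory.Automorphic.UnitaryGroupFormTransport
import Literature.RepresentationTheory.KonnoKonno2007.RealUnitaryRankOneKAK
import Literature.Analysis.SegalBargmann.SchwartzTorusIdentification
import Mathlib.Analysis.SpecialFunctions.Exponential
import HarnessLib

/-!
# The real unitary groups `U(J)` and `U(α, β)` as linear real groups, their regularity, and an adapted basis of `𝔲(2,1)`

[folklore] Junction file (node «W6b-hol» (AN), leaf AN-B part 1 of the pub-hodgecm cell's model DAG).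
`Literature.NumberTheory.Automorphic.RealMatrixGroups` axiomatises a *linear real group* `H ≤ GL_N(A)`
(`RealMatrixGroup`: closed subgroup, real Lie subalgebra `𝔥`, `exp (t X) ∈ H` for `X ∈ 𝔥`, `Ad H 𝔥 ⊆ 𝔥`,
stability under the conjugate transpose), and `ArchimedeanCalculusRegular` / `ArchimedeanSecondKindChart`
work under the REGULARITY hypothesis `hreg : ∀ X, (∀ t, exp (t X) ∈ H) → X ∈ 𝔥` ("`𝔥` is the full Lie
algebra of `H`").  This file provides both for the unitary group of a hermitian involution:

* § 1 (generic). For `J ∈ M_n(ℂ)` with `Jᴴ = J` and `J² = 1`: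
  `unitaryFormLie J = 𝔲(J) = {X | Xᴴ J + J X = 0}` (a real Lie subalgebra of `M_n(ℂ)`),
  `exp_conjTranspose_mul_mul_exp` (`(exp X)ᴴ J (exp X) = J` for `X ∈ 𝔲(J)`),
  **`unitaryFormGroup J hJ hJJ : RealMatrixGroup ℂ n`** with carrier the tree's
  `unitaryGroupOfForm (starRingEnd ℂ) J = {g | gᴴ J g = J}` (`UnitaryGroupAutomorphicRep`) and Lie algebra
  `𝔲(J)`, and **`unitaryFormGroup_regular`**: `(∀ t, exp (t X) ∈ U(J)) → X ∈ 𝔲(J)` — differentiate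
  `t ↦ (exp tX)ᴴ J (exp tX) ≡ J` at `t = 0`.
* § 2 (the junction frame of `KonnoKonno2007.RealUnitaryDualPair`). `uFormGroup α β := unitaryFormGroup
  (signForm α β) …`, whose carrier is `unitaryGroupOfForm (starRingEnd ℂ) (signForm α β)` and whose type of
  elements is `UForm α β` DEFINITIONALLY; `uFormGroup_regular`, `mem_uFormGroup_lie_iff`.
* § 3 (`U(2,1)` in the frame `Fin 2 ⊕ Unit`). Generators `torusGen a b = diag(−ia | −ib)` (any `α, β`) and
  `boostGen p = Y_p = −iE_{p∗} + iE_{∗p}` with their one-parameter groups computed in closed form: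
  `exp (s · torusGen a b) = kV (diagHom (torusPt (s • a)), diagHom (torusPt (s • b)))` (`exp_smul_torusGen`) and
  `exp (s · Y_p) = hypV p () s` (`exp_smul_boostGen`, by diagonalising `s Y_p` in the frame `plant p () (−i, i; 1, 1)`).
  The **adapted basis** `u21AdaptedBasis : Module.Basis (Fin 9) ℝ 𝔲(2,1)` consists of `X_i = g_i X⁰_i g_i⁻¹`
  (`u21Gen`, closed form `u21Gen_eq_explicit`), where the letter kind `u21Kind i : LetterKind` (`boost p | torus a b`)
  gives `X⁰_i = letterGen (u21Kind i)` and its one-parameter group `letterOf (u21Kind i)` (`hypV p ()`, resp. the compact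
  torus), and the frame `u21FrameK i ∈ U(2) × U(1)` gives `g_i = kV (u21FrameK i)` (frames `1`, `(w, 1)`, `(d₁w, 1)`,
  `(d₀, 1)`, `(d₁, 1)` with `w = (1/5)(3, 4; −4, 3)`, `d_p = diag(i at p)`).  **The exponential table**
  `expMem_smul_u21AdaptedBasis : (uFormGroup (Fin 2) Unit).expMem (s • u21AdaptedBasis i) =
  kV (u21FrameK i) * letterOf (u21Kind i) s * (kV (u21FrameK i))⁻¹` (also as `expGL_smul_u21Gen`, `exp_smul_u21Gen`);
  linear independence is read off six entries, spanning from the explicit coordinates `u21Coeff`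
  (`eq_sum_u21Coeff_smul`, `u21AdaptedBasis_repr`), `finrank_u21Lie : dim_ℝ 𝔲(2,1) = 9`.

All statements are kernel-proved; no records, no hypotheses beyond `Jᴴ = J`, `J² = 1`.

References: A. W. Knapp, *Lie Groups Beyond an Introduction* (2nd ed., 2002), Introduction (closed linear
groups), I.§1 Example (3) (`𝔲(p,q)`), I.§10 Prop. 1.88 ff. (the Lie algebra of a closed linear group is
`{X | exp tX ∈ G ∀ t}`), VII.§2 Example 2; the frame `U(α, β)` as in C. Mœglin, M.-F. Vignéras,
J.-L. Waldspurger, *Correspondances de Howe sur un corps p-adique*, LNM 1291 (1987), Ch. 1 I.17, and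
K. Konno, T. Konno, Kyushu J. Math. 61 (2007) §3.1.

Provenance. Written under the LEAN-IN-TREE rule for the pub-hodgecm formalisation cell: §§ 1–2 by construction
prover mc-autform-2 (gen 6), § 3 and assembly by DAG-node prover pv08 (gen 26); specification by mc-theta-1 (gen 5),
leaf AN-B (1)–(3) and its consumer shape (two index functions + one letter map).  Nothing here is a claim of the
manuscripts adjudicated by that cell.
-/

set_option autoImplicit false

noncomputable section

open scoped MatrixGroups Matrix ComplexConjugate
open NormedSpace -- for `exp`
open Literature.NumberTheory.Automorphic

-- the commutator bracket on `Matrix n n ℂ`, as in `Literature.NumberTheory.Automorphic.RealMatrixGroups`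
attribute [local instance 100] LieRing.ofAssociativeRing

namespace Literature.RepresentationTheory.KonnoKonno2007

/-! ### § 1. `𝔲(J)` and `U(J)` for a hermitian involution `J` -/

section Generic

variable {n : Type*} [Fintype n] [DecidableEq n]

/-- The Lie algebra `𝔲(J) = {X ∈ M_n(ℂ) : Xᴴ J + J X = 0}` of `U(J) = {g : gᴴ J g = J}`, a real Lie subalgebra
of `M_n(ℂ)` (closed under the commutator). Knapp 2002, I.§1 Example (3). [folklore] -/
def unitaryFormLie (J : Matrix n n ℂ) : LieSubalgebra ℝ (Matrix n n ℂ) where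
  carrier := {X | Xᴴ * J + J * X = 0}
  add_mem' {X Y} hX hY := by
    simp only [Set.mem_setOf_eq] at hX hY ⊢
    rw [Matrix.conjTranspose_add, Matrix.add_mul, Matrix.mul_add]
    calc Xᴴ * J + Yᴴ * J + (J * X + J * Y) = (Xᴴ * J + J * X) + (Yᴴ * J + J * Y) := by abel
      _ = 0 := by rw [hX, hY, add_zero]
  zero_mem' := by simp
  smul_mem' t X hX := by
    simp only [Set.mem_setOf_eq] at hX ⊢
    rw [Matrix.conjTranspose_smul, star_trivial, Matrix.smul_mul, Matrix.mul_smul, ← smul_add, hX,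
      smul_zero]
  lie_mem' {X Y} hX hY := by
    simp only [Set.mem_setOf_eq] at hX hY ⊢
    have hX' : Xᴴ * J = -(J * X) := eq_neg_of_add_eq_zero_left hX
    have hY' : Yᴴ * J = -(J * Y) := eq_neg_of_add_eq_zero_left hY
    rw [Ring.lie_def, Matrix.conjTranspose_sub, Matrix.conjTranspose_mul, Matrix.conjTranspose_mul,
      Matrix.sub_mul, Matrix.mul_assoc, hX', Matrix.mul_assoc Xᴴ, hY', Matrix.mul_neg, Matrix.mul_neg,
      ← Matrix.mul_assoc, ← Matrix.mul_assoc, hY', hX']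
    simp only [neg_mul, neg_neg, Matrix.mul_sub, Matrix.mul_assoc]
    abel

/-- Membership in `𝔲(J)`. Knapp 2002, I.§1. [folklore] -/
theorem mem_unitaryFormLie_iff (J X : Matrix n n ℂ) : X ∈ unitaryFormLie J ↔ Xᴴ * J + J * X = 0 := Iff.rfl

/-- For `J² = 1` and `X ∈ 𝔲(J)` the exponential preserves `J`: `(exp X)ᴴ J (exp X) = J`
(`(exp X)ᴴ = exp Xᴴ = exp (J (−X) J) = J exp(−X) J`). Knapp 2002, Introduction / I.§1. [folklore] -/
theorem exp_conjTranspose_mul_mul_exp {J : Matrix n n ℂ} (hJJ : J * J = 1) {X : Matrix n n ℂ}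
    (hX : Xᴴ * J + J * X = 0) : (exp X)ᴴ * J * exp X = J := by
  have hJu : IsUnit J := ⟨⟨J, J, hJJ, hJJ⟩, rfl⟩
  have hJinv : J⁻¹ = J := Matrix.inv_eq_left_inv hJJ
  have hXH : Xᴴ = J * (-X) * J⁻¹ := by
    have h1 : Xᴴ * J = -(J * X) := eq_neg_of_add_eq_zero_left hX
    calc Xᴴ = Xᴴ * (J * J) := by rw [hJJ, Matrix.mul_one]
      _ = (Xᴴ * J) * J := by rw [Matrix.mul_assoc]
      _ = J * (-X) * J⁻¹ := by rw [h1, hJinv, Matrix.mul_neg, Matrix.neg_mul]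
  rw [← Matrix.exp_conjTranspose, hXH, Matrix.exp_conj _ _ hJu, hJinv]
  calc J * exp (-X) * J * J * exp X = J * (exp (-X) * ((J * J) * exp X)) := by
        simp only [Matrix.mul_assoc]
    _ = J := by
        rw [hJJ, Matrix.one_mul, ← Matrix.exp_add_of_commute _ _ ((Commute.refl X).neg_left),
          neg_add_cancel, exp_zero, Matrix.mul_one]

/-- **`U(J)` as a linear real group** (`J` a hermitian involution: `Jᴴ = J`, `J² = 1`): carrier the tree's
`unitaryGroupOfForm (starRingEnd ℂ) J = {g ∈ GL_n(ℂ) | gᴴ J g = J}`, Lie algebra `𝔲(J)`; one-parameter groups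
of `𝔲(J)` lie in `U(J)`, `Ad g 𝔲(J) ⊆ 𝔲(J)`, `gᴴ ∈ U(J)` for `g ∈ U(J)` (via `J² = 1` and `mul_eq_one_comm`),
and `U(J)` is closed. Knapp 2002, Introduction (closed linear groups), I.§1 Example (3), VII.§2 Example 2.
[folklore] -/
def unitaryFormGroup (J : Matrix n n ℂ) (hJ : Jᴴ = J) (hJJ : J * J = 1) : RealMatrixGroup ℂ n where
  carrier := unitaryGroupOfForm (starRingEnd ℂ) J
  lie := unitaryFormLie J
  expGL_smul_mem X hX t := by
    rw [mem_unitaryGroupOfForm_star_iff_conjTranspose, coe_expGL]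
    exact exp_conjTranspose_mul_mul_exp hJJ ((unitaryFormLie J).smul_mem t hX)
  conj_mem_lie g hg X hX := by
    rw [mem_unitaryGroupOfForm_star_iff_conjTranspose] at hg
    rw [mem_unitaryFormLie_iff] at hX ⊢
    set gm : Matrix n n ℂ := (g : Matrix n n ℂ) with hgm
    set gi : Matrix n n ℂ := ((g⁻¹ : GL n ℂ) : Matrix n n ℂ) with hgi
    have hmul : gm * gi = 1 := by
      rw [hgm, hgi, ← Units.val_mul, mul_inv_cancel, Units.val_one]
    have ha : gmᴴ * J = J * gi := by
      calc gmᴴ * J = gmᴴ * J * (gm * gi) := by rw [hmul, Matrix.mul_one]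
        _ = J * gi := by rw [← Matrix.mul_assoc, hg]
    have hb : giᴴ * J = J * gm := by
      have := congrArg Matrix.conjTranspose ha
      simpa only [Matrix.conjTranspose_mul, Matrix.conjTranspose_conjTranspose, hJ] using this.symm
    have hX' : Xᴴ * J = -(J * X) := eq_neg_of_add_eq_zero_left hX
    rw [Matrix.conjTranspose_mul, Matrix.conjTranspose_mul, Matrix.mul_assoc, Matrix.mul_assoc, ha,
      ← Matrix.mul_assoc Xᴴ, hX', neg_mul, Matrix.mul_neg, ← Matrix.mul_assoc, ← Matrix.mul_assoc giᴴ J X, hb]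
    simp only [Matrix.mul_assoc, neg_add_cancel]
  star_mem g hg := by
    rw [mem_unitaryGroupOfForm_star_iff_conjTranspose] at hg ⊢
    set gm : Matrix n n ℂ := (g : Matrix n n ℂ) with hgm
    show (star gm)ᴴ * J * star gm = J
    rw [Matrix.star_eq_conjTranspose, Matrix.conjTranspose_conjTranspose]
    have h1 : J * gmᴴ * J * gm = 1 := by rw [Matrix.mul_assoc J, Matrix.mul_assoc J, hg, hJJ]
    have h2 : gm * (J * gmᴴ * J) = 1 := mul_eq_one_comm.1 (by simpa only [Matrix.mul_assoc] using h1)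
    calc gm * J * gmᴴ = gm * J * gmᴴ * (J * J) := by rw [hJJ, Matrix.mul_one]
      _ = gm * (J * gmᴴ * J) * J := by simp only [Matrix.mul_assoc]
      _ = J := by rw [h2, Matrix.one_mul]
  isClosed := by
    have hset : ((unitaryGroupOfForm (starRingEnd ℂ) J : Subgroup (GL n ℂ)) : Set (GL n ℂ)) =
        {g : GL n ℂ | (g : Matrix n n ℂ)ᴴ * J * (g : Matrix n n ℂ) = J} :=
      Set.ext fun g => mem_unitaryGroupOfForm_star_iff_conjTranspose J g
    rw [hset]
    exact isClosed_eq ((Units.continuous_val.matrix_conjTranspose.mul continuous_const).mul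
      Units.continuous_val) continuous_const

/-- The carrier of `unitaryFormGroup J` is `unitaryGroupOfForm (starRingEnd ℂ) J`. [folklore] -/
@[simp] theorem unitaryFormGroup_carrier (J : Matrix n n ℂ) (hJ : Jᴴ = J) (hJJ : J * J = 1) :
    (unitaryFormGroup J hJ hJJ).carrier = unitaryGroupOfForm (starRingEnd ℂ) J := rfl

/-- The Lie algebra of `unitaryFormGroup J` is `𝔲(J)`. [folklore] -/
@[simp] theorem unitaryFormGroup_lie (J : Matrix n n ℂ) (hJ : Jᴴ = J) (hJJ : J * J = 1) :
    (unitaryFormGroup J hJ hJJ).lie = unitaryFormLie J := rfl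

/-- Membership in the carrier of `unitaryFormGroup J`: `gᴴ J g = J`. [folklore] -/
theorem mem_unitaryFormGroup_carrier_iff (J : Matrix n n ℂ) (hJ : Jᴴ = J) (hJJ : J * J = 1) (g : GL n ℂ) :
    g ∈ (unitaryFormGroup J hJ hJJ).carrier ↔ (g : Matrix n n ℂ)ᴴ * J * (g : Matrix n n ℂ) = J :=
  mem_unitaryGroupOfForm_star_iff_conjTranspose J g

/-- Membership in the Lie algebra of `unitaryFormGroup J`: `Xᴴ J + J X = 0`. [folklore] -/
theorem mem_unitaryFormGroup_lie_iff (J : Matrix n n ℂ) (hJ : Jᴴ = J) (hJJ : J * J = 1) (X : Matrix n n ℂ) :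
    X ∈ (unitaryFormGroup J hJ hJJ).lie ↔ Xᴴ * J + J * X = 0 := Iff.rfl

-- The scoped `L∞` operator norm on matrices (reducibly defeq to the Pi topology, as in
-- `Mathlib/Analysis/Normed/Algebra/MatrixExponential.lean`) is used for `hasDerivAt_exp_smul_const'`.
set_option backward.isDefEq.respectTransparency false in
open scoped Matrix.Norms.Operator in
/-- **Regularity of `U(J)`: `𝔲(J)` is the full Lie algebra.** If `exp (t X) ∈ U(J)` for every real `t`,
then `X ∈ 𝔲(J)`: differentiating `t ↦ (exp tX)ᴴ J (exp tX) ≡ J` at `t = 0` gives `Xᴴ J + J X = 0`.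
Knapp 2002, I.§10 (Prop. 1.88 ff.: the Lie algebra of a closed linear group is `{X | exp tX ∈ G ∀ t}`).
[folklore] -/
theorem unitaryFormGroup_regular (J : Matrix n n ℂ) (hJ : Jᴴ = J) (hJJ : J * J = 1) (X : Matrix n n ℂ)
    (hX : ∀ t : ℝ, expGL (t • X) ∈ (unitaryFormGroup J hJ hJJ).carrier) :
    X ∈ (unitaryFormGroup J hJ hJJ).lie := by
  rw [mem_unitaryFormGroup_lie_iff]
  -- the curve `t ↦ (exp tX)ᴴ J (exp tX)` is constant `= J`
  have hconst : ∀ t : ℝ, (exp (t • X))ᴴ * J * exp (t • X) = J := fun t => by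
    have h := hX t
    rwa [mem_unitaryFormGroup_carrier_iff, coe_expGL] at h
  -- derivatives at `0` of `t ↦ exp tX` and `t ↦ (exp tX)ᴴ = exp (t Xᴴ)`
  have hE : HasDerivAt (fun u : ℝ => exp (u • X)) X 0 := by
    simpa using hasDerivAt_exp_smul_const' (𝕂 := ℝ) X 0
  have hEH : HasDerivAt (fun u : ℝ => (exp (u • X))ᴴ) Xᴴ 0 := by
    have hfun : (fun u : ℝ => (exp (u • X))ᴴ) = fun u : ℝ => exp (u • Xᴴ) := by
      funext u
      rw [← Matrix.exp_conjTranspose, Matrix.conjTranspose_smul, star_trivial]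
    rw [hfun]
    simpa using hasDerivAt_exp_smul_const' (𝕂 := ℝ) Xᴴ 0
  -- product rule, and the derivative of the constant curve is `0`
  have hprod : HasDerivAt (fun u : ℝ => (exp (u • X))ᴴ * J * exp (u • X))
      (Xᴴ * J * exp ((0 : ℝ) • X) + (exp ((0 : ℝ) • X))ᴴ * J * X) 0 :=
    (hEH.mul_const J).mul hE
  have hzero : HasDerivAt (fun u : ℝ => (exp (u • X))ᴴ * J * exp (u • X)) (0 : Matrix n n ℂ) 0 := by
    rw [show (fun u : ℝ => (exp (u • X))ᴴ * J * exp (u • X)) = fun _ => J from funext hconst]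
    exact hasDerivAt_const 0 J
  have h := hprod.unique hzero
  simpa [zero_smul, exp_zero, Matrix.conjTranspose_one] using h

end Generic

/-! ### § 2. The junction frame: `U(α, β)` -/

section Junction

variable (α β : Type*) [Fintype α] [DecidableEq α] [Fintype β] [DecidableEq β]

omit [Fintype α] [Fintype β] in
/-- `diag(1_α, −1_β)` is hermitian. [folklore] -/
theorem conjTranspose_signForm : (RealDualPair.signForm α β)ᴴ = RealDualPair.signForm α β := by
  rw [RealDualPair.signForm_eq_diagonal, Matrix.diagonal_conjTranspose]
  congr 1
  funext i
  rcases i with a | b <;> simp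

/-- `diag(1_α, −1_β)² = 1`. [folklore] -/
theorem signForm_mul_signForm : RealDualPair.signForm α β * RealDualPair.signForm α β = 1 := by
  rw [RealDualPair.signForm_eq_diagonal, Matrix.diagonal_mul_diagonal, ← Matrix.diagonal_one]
  congr 1
  funext i
  rcases i with a | b <;> simp

/-- **`U(α, β)` as a linear real group** in the junction frame of `RealUnitaryDualPair`: carrier
`unitaryGroupOfForm (starRingEnd ℂ) (signForm α β)` (so that its type of elements is `UForm α β`
definitionally), Lie algebra `𝔲(α, β) = {X | Xᴴ D + D X = 0}`, `D = diag(1_α, −1_β)`. Knapp 2002, I.§1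
Example (3); Mœglin–Vignéras–Waldspurger 1987, Ch. 1 I.17. [folklore] -/
def uFormGroup : RealMatrixGroup ℂ (α ⊕ β) :=
  unitaryFormGroup (RealDualPair.signForm α β) (conjTranspose_signForm α β) (signForm_mul_signForm α β)

/-- The carrier of `uFormGroup α β` is `unitaryGroupOfForm (starRingEnd ℂ) (signForm α β)` (`rfl`). [folklore] -/
@[simp] theorem uFormGroup_carrier :
    (uFormGroup α β).carrier = unitaryGroupOfForm (starRingEnd ℂ) (RealDualPair.signForm α β) := rfl

/-- The elements of `uFormGroup α β` are the elements of `UForm α β` (`rfl`). [folklore] -/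
theorem coeSort_uFormGroup_carrier : ↥(uFormGroup α β).carrier = RealDualPair.UForm α β := rfl

/-- The Lie algebra of `uFormGroup α β` is `𝔲(diag(1_α, −1_β))`. [folklore] -/
@[simp] theorem uFormGroup_lie : (uFormGroup α β).lie = unitaryFormLie (RealDualPair.signForm α β) := rfl

variable {α β}

/-- Membership in the Lie algebra of `uFormGroup α β`: `Xᴴ D + D X = 0`. [folklore] -/
theorem mem_uFormGroup_lie_iff (X : Matrix (α ⊕ β) (α ⊕ β) ℂ) :
    X ∈ (uFormGroup α β).lie ↔ Xᴴ * RealDualPair.signForm α β + RealDualPair.signForm α β * X = 0 := Iff.rfl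

/-- Membership in the carrier of `uFormGroup α β`: `gᴴ D g = D`. [folklore] -/
theorem mem_uFormGroup_carrier_iff (g : GL (α ⊕ β) ℂ) :
    g ∈ (uFormGroup α β).carrier ↔
      (g : Matrix (α ⊕ β) (α ⊕ β) ℂ)ᴴ * RealDualPair.signForm α β * (g : Matrix (α ⊕ β) (α ⊕ β) ℂ) =
        RealDualPair.signForm α β :=
  mem_unitaryGroupOfForm_star_iff_conjTranspose _ g

/-- An element of `UForm α β` lies in the carrier of `uFormGroup α β`. [folklore] -/
theorem coe_mem_uFormGroup_carrier (g : RealDualPair.UForm α β) : (g : GL (α ⊕ β) ℂ) ∈ (uFormGroup α β).carrier :=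
  g.2

/-- **Regularity of `U(α, β)`**: `exp (t X) ∈ U(α, β)` for all real `t` implies `X ∈ 𝔲(α, β)` — the
hypothesis `hreg` of `ArchimedeanCalculusRegular` for `uFormGroup α β`. Knapp 2002, I.§10. [folklore] -/
theorem uFormGroup_regular (X : Matrix (α ⊕ β) (α ⊕ β) ℂ)
    (hX : ∀ t : ℝ, expGL (t • X) ∈ (uFormGroup α β).carrier) : X ∈ (uFormGroup α β).lie :=
  unitaryFormGroup_regular _ _ _ X hX

end Junction

/-! ### § 3. `U(2,1)` in the frame `Fin 2 ⊕ Unit`: an adapted basis of `𝔲(2,1)` and its one-parameter groups -/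

section Generators

open RealDualPair RealDualPair.UForm Literature.Analysis.SegalBargmann
open Complex (I)

variable {α β : Type*} [Fintype α] [DecidableEq α] [Fintype β] [DecidableEq β]

/-- **Torus generator** with rates `(a, b)`: `diag(−i a_l | −i b_l)`, the velocity at `s = 0` of the compact torus
`s ↦ kV (diagHom (torusPt (s • a)), diagHom (torusPt (s • b)))` (`torusPt θ = (e^{−iθ_l})_l`). [folklore] -/
def torusGen (a : α → ℝ) (b : β → ℝ) : Matrix (α ⊕ β) (α ⊕ β) ℂ :=
  Matrix.diagonal (Sum.elim (fun l => -((a l : ℂ) * I)) (fun l => -((b l : ℂ) * I)))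

omit [Fintype α] [Fintype β] in
/-- entries of `torusGen a b`. [folklore] -/
@[simp] theorem torusGen_apply (a : α → ℝ) (b : β → ℝ) (x y : α ⊕ β) :
    torusGen a b x y = if x = y then Sum.elim (fun l => -((a l : ℂ) * I)) (fun l => -((b l : ℂ) * I)) x else 0 := by
  rw [torusGen, Matrix.diagonal_apply]

/-- `torusGen a b ∈ 𝔲(α, β)` (it is diagonal with imaginary entries). [folklore] -/
theorem torusGen_mem_lie (a : α → ℝ) (b : β → ℝ) : torusGen a b ∈ (uFormGroup α β).lie := by
  rw [mem_uFormGroup_lie_iff, torusGen, signForm_eq_diagonal, Matrix.diagonal_conjTranspose,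
    Matrix.diagonal_mul_diagonal, Matrix.diagonal_mul_diagonal, Matrix.diagonal_add]
  ext x y
  by_cases h : x = y
  · subst h
    rcases x with l | l <;> simp [Complex.conj_ofReal]
  · rw [Matrix.diagonal_apply_ne _ h, Matrix.zero_apply]

/-- **The torus one-parameter groups are exponentials**: `exp (s · torusGen a b) = kV (diag e^{−is a}, diag e^{−is b})`
as matrices. [folklore] -/
theorem exp_smul_torusGen (a : α → ℝ) (b : β → ℝ) (s : ℝ) :
    exp (s • torusGen a b) =
      (((kV α β (diagHom (torusPt (s • a)), diagHom (torusPt (s • b))) : UForm α β) : GL (α ⊕ β) ℂ) :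
        Matrix (α ⊕ β) (α ⊕ β) ℂ) := by
  have hexp : ∀ z : ℂ, exp z = Complex.exp z := fun z => by rw [Complex.exp_eq_exp_ℂ]
  rw [coe_kV, coe_diagHom, coe_diagHom, Matrix.fromBlocks_diagonal, torusGen, ← Matrix.diagonal_smul,
    Matrix.exp_diagonal, Pi.exp_def]
  congr 1
  funext x
  rcases x with l | l
  · simp only [Pi.smul_apply, Sum.elim_inl, hexp, torusPt, Circle.coe_exp, Complex.real_smul, Pi.smul_apply,
      smul_eq_mul, Complex.ofReal_neg, Complex.ofReal_mul]
    congr 1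
    ring
  · simp only [Pi.smul_apply, Sum.elim_inr, hexp, torusPt, Circle.coe_exp, Complex.real_smul, Pi.smul_apply,
      smul_eq_mul, Complex.ofReal_neg, Complex.ofReal_mul]
    congr 1
    ring

/-- **Boost generator** `Y_p = −i E_{p,∗} + i E_{∗,p}` (`p : Fin 2`, `∗` the `Unit` index): the velocity at `s = 0`
of the hyperbolic one-parameter group `s ↦ hypV p () s` of `RealUnitaryRankOneKAK`. [folklore] -/
def boostGen (p : Fin 2) : Matrix (Fin 2 ⊕ Unit) (Fin 2 ⊕ Unit) ℂ :=
  Matrix.of fun x y =>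
    match x, y with
    | Sum.inl a, Sum.inr _ => if a = p then -I else 0
    | Sum.inr _, Sum.inl a => if a = p then I else 0
    | _, _ => 0

/-- `Y_p` vanishes on the `α × α` block. [folklore] -/
@[simp] theorem boostGen_inl_inl (p a a' : Fin 2) : boostGen p (Sum.inl a) (Sum.inl a') = 0 := rfl

/-- `Y_p` vanishes on the `β × β` block. [folklore] -/
@[simp] theorem boostGen_inr_inr (p : Fin 2) (u u' : Unit) : boostGen p (Sum.inr u) (Sum.inr u') = 0 := rfl

/-- the `(p, ∗)` entry of `Y_p` is `−i`. [folklore] -/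
@[simp] theorem boostGen_inl_inr (p a : Fin 2) (u : Unit) :
    boostGen p (Sum.inl a) (Sum.inr u) = if a = p then -I else 0 := rfl

/-- the `(∗, p)` entry of `Y_p` is `i`. [folklore] -/
@[simp] theorem boostGen_inr_inl (p a : Fin 2) (u : Unit) :
    boostGen p (Sum.inr u) (Sum.inl a) = if a = p then I else 0 := rfl

/-- `Y_p ∈ 𝔲(2,1)`. [folklore] -/
theorem boostGen_mem_lie (p : Fin 2) : boostGen p ∈ (uFormGroup (Fin 2) Unit).lie := by
  rw [mem_uFormGroup_lie_iff]
  ext x y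
  rcases x with a | ⟨⟩ <;> rcases y with a' | ⟨⟩
  · fin_cases p <;> fin_cases a <;> fin_cases a' <;>
      simp [Matrix.mul_apply, Matrix.add_apply, Fintype.sum_sum_type, Matrix.fromBlocks, Matrix.conjTranspose_apply]
  · fin_cases p <;> fin_cases a <;>
      simp [Matrix.mul_apply, Matrix.add_apply, Fintype.sum_sum_type, Matrix.fromBlocks, Matrix.conjTranspose_apply]
  · fin_cases p <;> fin_cases a' <;>
      simp [Matrix.mul_apply, Matrix.add_apply, Fintype.sum_sum_type, Matrix.fromBlocks, Matrix.conjTranspose_apply]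
  · fin_cases p <;>
      simp [Matrix.mul_apply, Matrix.add_apply, Fintype.sum_sum_type, Matrix.fromBlocks, Matrix.conjTranspose_apply]

/-- frame diagonalising `Y_p`: columns `(−i, 1)`, `(i, 1)` (eigenvalues `1`, `−1` of `[[0, −i],[i, 0]]`) planted on the
plane `{e_p, e_∗}`, the identity elsewhere. [folklore] -/
def boostGenFrame (p : Fin 2) : Matrix (Fin 2 ⊕ Unit) (Fin 2 ⊕ Unit) ℂ := plant p () !![-I, I; 1, 1]

/-- its inverse `[[i/2, 1/2],[−i/2, 1/2]]` planted on `{e_p, e_∗}`. [folklore] -/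
def boostGenFrameInv (p : Fin 2) : Matrix (Fin 2 ⊕ Unit) (Fin 2 ⊕ Unit) ℂ := plant p () !![I / 2, 1 / 2; -I / 2, 1 / 2]

/-- the eigenvalue profile of `s · Y_p`: `s` at `e_p`, `−s` at `e_∗`, `0` at the other index. [folklore] -/
def boostGenDiag (p : Fin 2) (s : ℝ) : Fin 2 ⊕ Unit → ℂ :=
  Sum.elim (fun a => if a = p then (s : ℂ) else 0) (fun _ => -(s : ℂ))

/-- `R R⁻¹ = 1`. [folklore] -/
theorem boostGenFrame_mul_inv (p : Fin 2) : boostGenFrame p * boostGenFrameInv p = 1 := by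
  rw [boostGenFrame, boostGenFrameInv, ← RealDualPair.plant_mul, ← RealDualPair.plant_one p ()]
  congr 1
  ext i j
  fin_cases i <;> fin_cases j <;> simp [Matrix.mul_apply, Fin.sum_univ_two] <;>
    (first | ring1 | (ring_nf; simp only [Complex.I_sq]; ring_nf))

/-- `R` is invertible. [folklore] -/
theorem isUnit_boostGenFrame (p : Fin 2) : IsUnit (boostGenFrame p) :=
  letI := invertibleOfRightInverse _ _ (boostGenFrame_mul_inv p)
  isUnit_of_invertible _

/-- the nonsingular inverse of `R` is `boostGenFrameInv`. [folklore] -/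
theorem boostGenFrame_inv (p : Fin 2) : (boostGenFrame p)⁻¹ = boostGenFrameInv p :=
  Matrix.inv_eq_right_inv (boostGenFrame_mul_inv p)

/-- `s · Y_p = R · diag(s, −s | 0) · R⁻¹`. [folklore] -/
theorem smul_boostGen_eq_conj (p : Fin 2) (s : ℝ) :
    s • boostGen p = boostGenFrame p * Matrix.diagonal (boostGenDiag p s) * (boostGenFrame p)⁻¹ := by
  rw [boostGenFrame_inv p]
  ext x y
  rcases x with a | ⟨⟩ <;> rcases y with a' | ⟨⟩
  · fin_cases p <;> fin_cases a <;> fin_cases a' <;>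
      simp [boostGenFrame, boostGenFrameInv, boostGenDiag, Matrix.mul_apply, Fintype.sum_sum_type, Fin.sum_univ_two,
        Matrix.diagonal] <;>
          ring1
  · fin_cases p <;> fin_cases a <;>
      simp [boostGenFrame, boostGenFrameInv, boostGenDiag, Matrix.mul_apply, Fintype.sum_sum_type,
        Matrix.diagonal, Complex.real_smul] <;>
          ring1
  · fin_cases p <;> fin_cases a' <;>
      simp [boostGenFrame, boostGenFrameInv, boostGenDiag, Matrix.mul_apply, Fintype.sum_sum_type,
        Matrix.diagonal, Complex.real_smul] <;>
          ring1
  · fin_cases p <;>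
      simp [boostGenFrame, boostGenFrameInv, boostGenDiag, Matrix.mul_apply, Fintype.sum_sum_type, Matrix.diagonal]

/-- **The hyperbolic one-parameter groups are exponentials**: `exp (s · Y_p) = hypV p () s` as matrices, i.e.
`plant p () [[cosh s, −i sinh s],[i sinh s, cosh s]]`. [folklore] -/
theorem exp_smul_boostGen (p : Fin 2) (s : ℝ) :
    exp (s • boostGen p) =
      (((hypV p () s : UForm (Fin 2) Unit) : GL (Fin 2 ⊕ Unit) ℂ) : Matrix (Fin 2 ⊕ Unit) (Fin 2 ⊕ Unit) ℂ) := by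
  have hexp : ∀ z : ℂ, exp z = Complex.exp z := fun z => by rw [Complex.exp_eq_exp_ℂ]
  rw [smul_boostGen_eq_conj, Matrix.exp_conj _ _ (isUnit_boostGenFrame p), Matrix.exp_diagonal, boostGenFrame_inv p,
    Pi.exp_def, coe_hypV]
  ext x y
  rcases x with a | ⟨⟩ <;> rcases y with a' | ⟨⟩
  · fin_cases p <;> fin_cases a <;> fin_cases a' <;>
      simp [boostGenFrame, boostGenFrameInv, boostGenDiag, Matrix.mul_apply, Fintype.sum_sum_type, Fin.sum_univ_two,
        Matrix.diagonal, hexp, Real.cosh_eq, Complex.ofReal_exp] <;>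
          (first | ring1 | (ring_nf; simp only [Complex.I_sq]; ring_nf))
  · fin_cases p <;> fin_cases a <;>
      simp [boostGenFrame, boostGenFrameInv, boostGenDiag, Matrix.mul_apply, Fintype.sum_sum_type,
        Matrix.diagonal, hexp, Real.sinh_eq, Complex.ofReal_exp] <;>
          ring1
  · fin_cases p <;> fin_cases a' <;>
      simp [boostGenFrame, boostGenFrameInv, boostGenDiag, Matrix.mul_apply, Fintype.sum_sum_type,
        Matrix.diagonal, hexp, Real.sinh_eq, Complex.ofReal_exp] <;>
          ring1
  · fin_cases p <;>
      simp [boostGenFrame, boostGenFrameInv, boostGenDiag, Matrix.mul_apply, Fintype.sum_sum_type,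
        Matrix.diagonal, hexp, Real.cosh_eq, Complex.ofReal_exp] <;>
          ring1

/-- the rational rotation `w = (1/5)·[[3, 4],[−4, 3]] ∈ U(2)` (a `3-4-5` rotation: entries in `ℚ`). [folklore] -/
def rotW : Matrix.unitaryGroup (Fin 2) ℂ :=
  ⟨!![3 / 5, 4 / 5; -4 / 5, 3 / 5], by
    rw [Matrix.mem_unitaryGroup_iff]
    ext i j
    fin_cases i <;> fin_cases j <;> simp [Matrix.mul_apply, Fin.sum_univ_two, Matrix.star_apply, Complex.conj_ofNat] <;> norm_num⟩

/-- matrix of `rotW`. [folklore] -/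
@[simp] theorem coe_rotW : ((rotW : Matrix.unitaryGroup (Fin 2) ℂ) : Matrix (Fin 2) (Fin 2) ℂ) =
    !![3 / 5, 4 / 5; -4 / 5, 3 / 5] := rfl

/-- the phase `d_p = diag(i at p, 1 elsewhere) ∈ U(2)`. [folklore] -/
def phaseDiag (p : Fin 2) : Matrix.unitaryGroup (Fin 2) ℂ :=
  ⟨Matrix.diagonal fun a => if a = p then I else 1, by
    rw [Matrix.mem_unitaryGroup_iff, Matrix.star_eq_conjTranspose, Matrix.diagonal_conjTranspose,
      Matrix.diagonal_mul_diagonal, ← Matrix.diagonal_one]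
    congr 1
    funext a
    by_cases h : a = p <;> simp [h]⟩

/-- matrix of `phaseDiag p`. [folklore] -/
@[simp] theorem coe_phaseDiag (p : Fin 2) : ((phaseDiag p : Matrix.unitaryGroup (Fin 2) ℂ) : Matrix (Fin 2) (Fin 2) ℂ) =
    Matrix.diagonal fun a => if a = p then I else 1 := rfl

end Generators

/-! #### The adapted basis: nine generators, each conjugate under `K = U(2) × U(1)` to a torus or a boost direction

The one-parameter groups are exposed through two index functions (`u21Kind`, `u21FrameK`) and one letter map (`letterOf`),
so that a consumer never identifies a matrix: `expMem (s • u21AdaptedBasis i) = kV (u21FrameK i) * letterOf (u21Kind i) s *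
(kV (u21FrameK i))⁻¹` (`expMem_smul_u21AdaptedBasis`). -/

section AdaptedBasis

open RealDualPair RealDualPair.UForm Literature.Analysis.SegalBargmann
open Complex (I)

variable {α β : Type*} [Fintype α] [DecidableEq α] [Fintype β] [DecidableEq β]

/-- **The compact torus one-parameter group** with rates `(a, b)`: `s ↦ kV (diag e^{−is a}, diag e^{−is b}) ∈ K ≤ U(α, β)`
(`torusPt θ = (e^{−iθ_l})_l`, the sign convention of `SchwartzTorusIdentification`). [folklore] -/
def torusOneParam (a : α → ℝ) (b : β → ℝ) (s : ℝ) : UForm α β :=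
  kV α β (diagHom (torusPt (s • a)), diagHom (torusPt (s • b)))

/-- matrix of `torusOneParam a b s` = `exp (s · torusGen a b)`. [folklore] -/
theorem coe_torusOneParam (a : α → ℝ) (b : β → ℝ) (s : ℝ) :
    (((torusOneParam a b s : UForm α β) : GL (α ⊕ β) ℂ) : Matrix (α ⊕ β) (α ⊕ β) ℂ) = exp (s • torusGen a b) :=
  (exp_smul_torusGen a b s).symm

/-- **The real boost generator** `Z_p = E_{p,∗} + E_{∗,p} = Ad(d_p) Y_p` (`d_p = diag(i at p)`). [folklore] -/
def realBoostGen (p : Fin 2) : Matrix (Fin 2 ⊕ Unit) (Fin 2 ⊕ Unit) ℂ :=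
  Matrix.of fun x y =>
    match x, y with
    | Sum.inl a, Sum.inr _ => if a = p then 1 else 0
    | Sum.inr _, Sum.inl a => if a = p then 1 else 0
    | _, _ => 0

/-- `Z_p` vanishes on the `α × α` block. [folklore] -/
@[simp] theorem realBoostGen_inl_inl (p a a' : Fin 2) : realBoostGen p (Sum.inl a) (Sum.inl a') = 0 := rfl

/-- `Z_p` vanishes on the `β × β` block. [folklore] -/
@[simp] theorem realBoostGen_inr_inr (p : Fin 2) (u u' : Unit) : realBoostGen p (Sum.inr u) (Sum.inr u') = 0 := rfl

/-- the `(p, ∗)` entry of `Z_p` is `1`. [folklore] -/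
@[simp] theorem realBoostGen_inl_inr (p a : Fin 2) (u : Unit) :
    realBoostGen p (Sum.inl a) (Sum.inr u) = if a = p then 1 else 0 := rfl

/-- the `(∗, p)` entry of `Z_p` is `1`. [folklore] -/
@[simp] theorem realBoostGen_inr_inl (p a : Fin 2) (u : Unit) :
    realBoostGen p (Sum.inr u) (Sum.inl a) = if a = p then 1 else 0 := rfl

/-- **The two kinds of letters** of the adapted basis: a boost `hypV p ()` in the coordinate plane `p`, or a compact torus with
rates `(a, b)`. [folklore] -/
inductive LetterKind : Type
  /-- the boost `s ↦ hypV p () s` -/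
  | boost (p : Fin 2)
  /-- the compact torus `s ↦ kV (diagHom (torusPt (s • a)), diagHom (torusPt (s • b)))` -/
  | torus (a : Fin 2 → ℝ) (b : Unit → ℝ)

/-- **The one-parameter group of a letter**: `boost p ↦ hypV p ()`,
`torus a b ↦ fun s => kV (diagHom (torusPt (s • a)), diagHom (torusPt (s • b)))`. [folklore] -/
def letterOf : LetterKind → ℝ → UForm (Fin 2) Unit
  | .boost p => hypV p ()
  | .torus a b => fun s => kV (Fin 2) Unit (diagHom (torusPt (s • a)), diagHom (torusPt (s • b)))

/-- `letterOf (boost p) = hypV p ()`. [folklore] -/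
@[simp] theorem letterOf_boost (p : Fin 2) : letterOf (.boost p) = hypV p () := rfl

/-- `letterOf (torus a b) s = kV (diagHom (torusPt (s • a)), diagHom (torusPt (s • b)))`. [folklore] -/
@[simp] theorem letterOf_torus (a : Fin 2 → ℝ) (b : Unit → ℝ) (s : ℝ) :
    letterOf (.torus a b) s = kV (Fin 2) Unit (diagHom (torusPt (s • a)), diagHom (torusPt (s • b))) := rfl

/-- `letterOf (torus a b) = torusOneParam a b`. [folklore] -/
theorem letterOf_torus_eq (a : Fin 2 → ℝ) (b : Unit → ℝ) : letterOf (.torus a b) = torusOneParam a b := rfl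

/-- **The generator of a letter**: `boost p ↦ Y_p = boostGen p`, `torus a b ↦ torusGen a b`. [folklore] -/
def letterGen : LetterKind → Matrix (Fin 2 ⊕ Unit) (Fin 2 ⊕ Unit) ℂ
  | .boost p => boostGen p
  | .torus a b => torusGen a b

/-- `letterGen (boost p) = boostGen p`. [folklore] -/
@[simp] theorem letterGen_boost (p : Fin 2) : letterGen (.boost p) = boostGen p := rfl

/-- `letterGen (torus a b) = torusGen a b`. [folklore] -/
@[simp] theorem letterGen_torus (a : Fin 2 → ℝ) (b : Unit → ℝ) : letterGen (.torus a b) = torusGen a b := rfl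

/-- the generator of a letter lies in `𝔲(2,1)`. [folklore] -/
theorem letterGen_mem_lie (k : LetterKind) : letterGen k ∈ (uFormGroup (Fin 2) Unit).lie := by
  cases k with
  | boost p => exact boostGen_mem_lie p
  | torus a b => exact torusGen_mem_lie a b

/-- **`exp (s · letterGen k) = letterOf k s`**: the letter is the one-parameter group of its generator. [folklore] -/
theorem exp_smul_letterGen (k : LetterKind) (s : ℝ) :
    exp (s • letterGen k) = (((letterOf k s : UForm (Fin 2) Unit) : GL (Fin 2 ⊕ Unit) ℂ) : Matrix (Fin 2 ⊕ Unit) (Fin 2 ⊕ Unit) ℂ) := by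
  cases k with
  | boost p => exact exp_smul_boostGen p s
  | torus a b => exact exp_smul_torusGen a b s

/-- **The letter kinds of the nine generators**: the torus directions `iE₀₀`, `iE₁₁`, `iE_{∗∗}`, twice `i(E₀₀ − E₁₁)`
(rates `(−1,0 | 0)`, `(0,−1 | 0)`, `(0,0 | −1)`, `(−1,1 | 0)`, `(−1,1 | 0)`), then the boosts in the planes `0, 1, 0, 1`. [folklore] -/
def u21Kind : Fin 9 → LetterKind :=
  ![.torus ![-1, 0] 0, .torus ![0, -1] 0, .torus 0 (fun _ => -1), .torus ![-1, 1] 0, .torus ![-1, 1] 0,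
    .boost 0, .boost 1, .boost 0, .boost 1]

/-- **The `K`-frames of the nine generators** (`K = U(2) × U(1)`): `1, 1, 1, (w, 1), (d₁ w, 1), 1, 1, (d₀, 1), (d₁, 1)` with
`w = (1/5)·(3, 4; −4, 3)` (`rotW`) and `d_p = diag(i at p)` (`phaseDiag p`). [folklore] -/
def u21FrameK : Fin 9 → Matrix.unitaryGroup (Fin 2) ℂ × Matrix.unitaryGroup Unit ℂ :=
  ![1, 1, 1, (rotW, 1), (phaseDiag 1 * rotW, 1), 1, 1, (phaseDiag 0, 1), (phaseDiag 1, 1)]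

/-- **The base directions** `X⁰_i = letterGen (u21Kind i)`. [folklore] -/
def u21BaseGen (i : Fin 9) : Matrix (Fin 2 ⊕ Unit) (Fin 2 ⊕ Unit) ℂ :=
  letterGen (u21Kind i)

/-- **The conjugators** `g_i = kV (u21FrameK i) ∈ K`, BY DEFINITION in the range of `kV`. [folklore] -/
def u21AdaptedConj (i : Fin 9) : UForm (Fin 2) Unit :=
  kV (Fin 2) Unit (u21FrameK i)

/-- `g_i ∈ kV (U(2) × U(1))`. [folklore] -/
theorem u21AdaptedConj_mem_range (i : Fin 9) : u21AdaptedConj i ∈ Set.range (kV (Fin 2) Unit) :=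
  ⟨u21FrameK i, rfl⟩

/-- **The base one-parameter groups** `L_i = letterOf (u21Kind i) : ℝ → U(2,1)`. [folklore] -/
def u21AdaptedOneParam (i : Fin 9) : ℝ → UForm (Fin 2) Unit :=
  letterOf (u21Kind i)

/-- **The adapted generators** `X_i = g_i X⁰_i g_i⁻¹` of `𝔲(2,1)` (`i < 9`). [folklore] -/
def u21Gen (i : Fin 9) : Matrix (Fin 2 ⊕ Unit) (Fin 2 ⊕ Unit) ℂ :=
  (((u21AdaptedConj i : UForm (Fin 2) Unit) : GL (Fin 2 ⊕ Unit) ℂ) : Matrix (Fin 2 ⊕ Unit) (Fin 2 ⊕ Unit) ℂ) *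
    u21BaseGen i *
    ((((u21AdaptedConj i : UForm (Fin 2) Unit) : GL (Fin 2 ⊕ Unit) ℂ)⁻¹ : GL (Fin 2 ⊕ Unit) ℂ) :
      Matrix (Fin 2 ⊕ Unit) (Fin 2 ⊕ Unit) ℂ)

/-- the base directions lie in `𝔲(2,1)`. [folklore] -/
theorem u21BaseGen_mem_lie (i : Fin 9) : u21BaseGen i ∈ (uFormGroup (Fin 2) Unit).lie :=
  letterGen_mem_lie _

/-- **`X_i ∈ 𝔲(2,1)`** (`Ad K`-stability of `𝔲(2,1)`). [folklore] -/
theorem u21Gen_mem_lie (i : Fin 9) : u21Gen i ∈ (uFormGroup (Fin 2) Unit).lie :=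
  (uFormGroup (Fin 2) Unit).conj_mem_lie _ (u21AdaptedConj i).2 _ (u21BaseGen_mem_lie i)

/-- the base one-parameter groups are the exponentials of the base directions: `exp (s X⁰_i) = L_i(s)`. [folklore] -/
theorem exp_smul_u21BaseGen (i : Fin 9) (s : ℝ) :
    exp (s • u21BaseGen i) =
      (((u21AdaptedOneParam i s : UForm (Fin 2) Unit) : GL (Fin 2 ⊕ Unit) ℂ) : Matrix (Fin 2 ⊕ Unit) (Fin 2 ⊕ Unit) ℂ) :=
  exp_smul_letterGen _ s

/-- **The exponential table** (matrix form): `exp (s X_i) = g_i L_i(s) g_i⁻¹`. [folklore] -/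
theorem exp_smul_u21Gen (i : Fin 9) (s : ℝ) :
    exp (s • u21Gen i) =
      (((u21AdaptedConj i * u21AdaptedOneParam i s * (u21AdaptedConj i)⁻¹ : UForm (Fin 2) Unit) :
        GL (Fin 2 ⊕ Unit) ℂ) : Matrix (Fin 2 ⊕ Unit) (Fin 2 ⊕ Unit) ℂ) := by
  rw [u21Gen, ← Matrix.smul_mul, ← Matrix.mul_smul, Matrix.exp_units_conj, exp_smul_u21BaseGen]
  rfl

/-- **The exponential table** (`GL` form): `expGL (s X_i) = g_i L_i(s) g_i⁻¹` in `GL₃(ℂ)`. [folklore] -/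
theorem expGL_smul_u21Gen (i : Fin 9) (s : ℝ) :
    expGL (s • u21Gen i) =
      ((u21AdaptedConj i * u21AdaptedOneParam i s * (u21AdaptedConj i)⁻¹ : UForm (Fin 2) Unit) : GL (Fin 2 ⊕ Unit) ℂ) :=
  Units.ext (exp_smul_u21Gen i s)

/-- **The exponential table** (`GL` form, letters spelled out):
`expGL (s X_i) = kV (u21FrameK i) * letterOf (u21Kind i) s * (kV (u21FrameK i))⁻¹`. [folklore] -/
theorem expGL_smul_u21Gen_eq (i : Fin 9) (s : ℝ) :
    expGL (s • u21Gen i) =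
      ((kV (Fin 2) Unit (u21FrameK i) * letterOf (u21Kind i) s * (kV (Fin 2) Unit (u21FrameK i))⁻¹ :
        UForm (Fin 2) Unit) : GL (Fin 2 ⊕ Unit) ℂ) :=
  expGL_smul_u21Gen i s

/-- `exp (s X_i) ∈ U(2,1)`. [folklore] -/
theorem expGL_smul_u21Gen_mem (i : Fin 9) (s : ℝ) : expGL (s • u21Gen i) ∈ (uFormGroup (Fin 2) Unit).carrier := by
  rw [expGL_smul_u21Gen]
  exact (u21AdaptedConj i * u21AdaptedOneParam i s * (u21AdaptedConj i)⁻¹).2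

end AdaptedBasis

/-! #### Closed forms, linear independence, spanning: `u21AdaptedBasis` -/

section Basis

open RealDualPair RealDualPair.UForm Literature.Analysis.SegalBargmann
open Complex (I)

/-- **The adapted generators, explicitly**: `iE₀₀, iE₁₁, iE_{∗∗}`, `(i/25)(−7(E₀₀−E₁₁) − 24(E₀₁+E₁₀))`,
`(1/25)(−7i(E₀₀−E₁₁) − 24E₀₁ + 24E₁₀)`, `Y₀, Y₁, Z₀, Z₁` — all entries in `ℚ(i)`. [folklore] -/
def u21GenExplicit : Fin 9 → Matrix (Fin 2 ⊕ Unit) (Fin 2 ⊕ Unit) ℂ :=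
  ![torusGen ![-1, 0] 0, torusGen ![0, -1] 0, torusGen 0 (fun _ => -1),
    Matrix.fromBlocks !![-(7 / 25 : ℂ) * I, -(24 / 25 : ℂ) * I; -(24 / 25 : ℂ) * I, (7 / 25 : ℂ) * I] 0 0 0,
    Matrix.fromBlocks !![-(7 / 25 : ℂ) * I, -(24 / 25 : ℂ); (24 / 25 : ℂ), (7 / 25 : ℂ) * I] 0 0 0,
    boostGen 0, boostGen 1, realBoostGen 0, realBoostGen 1]

/-- a real combination `∑ i, c i • X_i` of the explicit generators, written out. [folklore] -/
theorem sum_smul_u21GenExplicit (c : Fin 9 → ℝ) :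
    ∑ i, c i • u21GenExplicit i =
      c 0 • u21GenExplicit 0 + c 1 • u21GenExplicit 1 + c 2 • u21GenExplicit 2 + c 3 • u21GenExplicit 3 +
        c 4 • u21GenExplicit 4 + c 5 • u21GenExplicit 5 + c 6 • u21GenExplicit 6 + c 7 • u21GenExplicit 7 +
        c 8 • u21GenExplicit 8 := by
  rw [Fin.sum_univ_castSucc, Fin.sum_univ_eight]
  rfl

/-- **`X_i = g_i X⁰_i g_i⁻¹` in closed form.** [folklore] -/
theorem u21Gen_eq_explicit (i : Fin 9) : u21Gen i = u21GenExplicit i := by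
  rw [u21Gen, Units.mul_inv_eq_iff_eq_mul]
  ext x y
  fin_cases i <;> rcases x with a | ⟨⟩ <;> rcases y with a' | ⟨⟩ <;> (try fin_cases a) <;> (try fin_cases a') <;>
    simp [u21AdaptedConj, u21FrameK, u21BaseGen, u21Kind, u21GenExplicit, Matrix.mul_apply, Fintype.sum_sum_type,
      Fin.sum_univ_two, Matrix.diagonal, Matrix.one_apply] <;>
    (first | ring1 | (ring_nf; simp only [Complex.I_sq]; ring_nf))

/-- the family `u21Gen` is the explicit family. [folklore] -/
theorem u21Gen_eq_explicit' : u21Gen = u21GenExplicit := funext u21Gen_eq_explicit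

/-- **Linear independence over `ℝ`** of the nine explicit generators (read off six entries). [folklore] -/
theorem linearIndependent_u21GenExplicit : LinearIndependent ℝ u21GenExplicit := by
  rw [Fintype.linearIndependent_iff]
  intro c hc
  rw [sum_smul_u21GenExplicit] at hc
  have e : ∀ x y, (c 0 • u21GenExplicit 0 + c 1 • u21GenExplicit 1 + c 2 • u21GenExplicit 2 + c 3 • u21GenExplicit 3 +
      c 4 • u21GenExplicit 4 + c 5 • u21GenExplicit 5 + c 6 • u21GenExplicit 6 + c 7 • u21GenExplicit 7 +
      c 8 • u21GenExplicit 8) x y = 0 := fun x y => by rw [hc]; rfl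
  have h00 := congrArg Complex.im (e (Sum.inl 0) (Sum.inl 0))
  have h11 := congrArg Complex.im (e (Sum.inl 1) (Sum.inl 1))
  have h22 := congrArg Complex.im (e (Sum.inr ()) (Sum.inr ()))
  have h01r := congrArg Complex.re (e (Sum.inl 0) (Sum.inl 1))
  have h01i := congrArg Complex.im (e (Sum.inl 0) (Sum.inl 1))
  have h02r := congrArg Complex.re (e (Sum.inl 0) (Sum.inr ()))
  have h02i := congrArg Complex.im (e (Sum.inl 0) (Sum.inr ()))
  have h12r := congrArg Complex.re (e (Sum.inl 1) (Sum.inr ()))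
  have h12i := congrArg Complex.im (e (Sum.inl 1) (Sum.inr ()))
  simp [u21GenExplicit, Matrix.add_apply, Matrix.smul_apply] at h00 h11 h22 h01r h01i h02r h02i h12r h12i
  intro i
  fin_cases i <;> simp <;> linarith

/-- **Linear independence over `ℝ` of `X₀, …, X₈`.** [folklore] -/
theorem linearIndependent_u21Gen : LinearIndependent ℝ u21Gen := by
  rw [u21Gen_eq_explicit']
  exact linearIndependent_u21GenExplicit

/-- **Coordinates on `𝔲(2,1)`** adapted to `X₀, …, X₈`: real-linear functionals of the entries. [folklore] -/
def u21Coeff (X : Matrix (Fin 2 ⊕ Unit) (Fin 2 ⊕ Unit) ℂ) : Fin 9 → ℝ :=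
  ![(X (Sum.inl 0) (Sum.inl 0)).im - 7 / 24 * ((X (Sum.inl 0) (Sum.inl 1)).im + (X (Sum.inl 0) (Sum.inl 1)).re),
    (X (Sum.inl 1) (Sum.inl 1)).im + 7 / 24 * ((X (Sum.inl 0) (Sum.inl 1)).im + (X (Sum.inl 0) (Sum.inl 1)).re),
    (X (Sum.inr ()) (Sum.inr ())).im,
    -(25 / 24) * (X (Sum.inl 0) (Sum.inl 1)).im,
    -(25 / 24) * (X (Sum.inl 0) (Sum.inl 1)).re,
    -(X (Sum.inl 0) (Sum.inr ())).im,
    -(X (Sum.inl 1) (Sum.inr ())).im,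
    (X (Sum.inl 0) (Sum.inr ())).re,
    (X (Sum.inl 1) (Sum.inr ())).re]

/-- **Every `X ∈ 𝔲(2,1)` is the real combination `∑ u21Coeff X i • X_i`** (the hermitian constraints
`X₀₀, X₁₁, X_{∗∗} ∈ iℝ`, `X₁₀ = −X̄₀₁`, `X_{∗p} = X̄_{p∗}`). [folklore] -/
theorem eq_sum_u21Coeff_smul {X : Matrix (Fin 2 ⊕ Unit) (Fin 2 ⊕ Unit) ℂ} (hX : X ∈ (uFormGroup (Fin 2) Unit).lie) :
    X = ∑ i, u21Coeff X i • u21GenExplicit i := by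
  have h := (mem_uFormGroup_lie_iff X).1 hX
  have e : ∀ x y, (Xᴴ * signForm (Fin 2) Unit + signForm (Fin 2) Unit * X) x y = 0 := fun x y => by rw [h]; rfl
  have k00 := congrArg Complex.re (e (Sum.inl 0) (Sum.inl 0))
  have k11 := congrArg Complex.re (e (Sum.inl 1) (Sum.inl 1))
  have k22 := congrArg Complex.re (e (Sum.inr ()) (Sum.inr ()))
  have k10r := congrArg Complex.re (e (Sum.inl 1) (Sum.inl 0))
  have k10i := congrArg Complex.im (e (Sum.inl 1) (Sum.inl 0))
  have k20r := congrArg Complex.re (e (Sum.inr ()) (Sum.inl 0))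
  have k20i := congrArg Complex.im (e (Sum.inr ()) (Sum.inl 0))
  have k21r := congrArg Complex.re (e (Sum.inr ()) (Sum.inl 1))
  have k21i := congrArg Complex.im (e (Sum.inr ()) (Sum.inl 1))
  simp [Matrix.add_apply, Matrix.mul_apply, Fintype.sum_sum_type, Matrix.fromBlocks, Matrix.conjTranspose_apply,
    Matrix.one_apply] at k00 k11 k22 k10r k10i k20r k20i k21r k21i
  rw [sum_smul_u21GenExplicit]
  ext x y
  rcases x with a | ⟨⟩ <;> rcases y with a' | ⟨⟩ <;> (try fin_cases a) <;> (try fin_cases a') <;>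
    simp [u21Coeff, u21GenExplicit, Matrix.add_apply, Matrix.smul_apply, Complex.ext_iff] <;>
    (try constructor) <;> linarith

/-- **Spanning**: `𝔲(2,1) ⊆ span_ℝ {X₀, …, X₈}`. [folklore] -/
theorem mem_span_u21Gen {X : Matrix (Fin 2 ⊕ Unit) (Fin 2 ⊕ Unit) ℂ} (hX : X ∈ (uFormGroup (Fin 2) Unit).lie) :
    X ∈ Submodule.span ℝ (Set.range u21Gen) := by
  rw [eq_sum_u21Coeff_smul hX, u21Gen_eq_explicit']
  exact Submodule.sum_mem _ fun i _ => Submodule.smul_mem _ _ (Submodule.subset_span (Set.mem_range_self i))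

/-- the adapted generators as elements of the real vector space `𝔲(2,1)`. [folklore] -/
def u21GenMem (i : Fin 9) : ↥(uFormGroup (Fin 2) Unit).lie.toSubmodule := ⟨u21Gen i, u21Gen_mem_lie i⟩

/-- coercion of `u21GenMem i`. [folklore] -/
@[simp] theorem coe_u21GenMem (i : Fin 9) :
    ((u21GenMem i : ↥(uFormGroup (Fin 2) Unit).lie.toSubmodule) : Matrix (Fin 2 ⊕ Unit) (Fin 2 ⊕ Unit) ℂ) = u21Gen i :=
  rfl

/-- linear independence of `u21GenMem`. [folklore] -/
theorem linearIndependent_u21GenMem : LinearIndependent ℝ u21GenMem :=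
  LinearIndependent.of_comp (uFormGroup (Fin 2) Unit).lie.toSubmodule.subtype linearIndependent_u21Gen

/-- `u21GenMem` spans `𝔲(2,1)`. [folklore] -/
theorem span_u21GenMem : ⊤ ≤ Submodule.span ℝ (Set.range u21GenMem) := by
  rintro ⟨X, hX⟩ -
  have hsum : (⟨X, hX⟩ : ↥(uFormGroup (Fin 2) Unit).lie.toSubmodule) = ∑ i, u21Coeff X i • u21GenMem i := by
    apply Subtype.ext
    rw [Submodule.coe_sum]
    simp only [Submodule.coe_smul, coe_u21GenMem, u21Gen_eq_explicit']
    exact eq_sum_u21Coeff_smul hX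
  rw [hsum]
  exact Submodule.sum_mem _ fun i _ => Submodule.smul_mem _ _ (Submodule.subset_span (Set.mem_range_self i))

/-- **The adapted basis of `𝔲(2,1)`**: `X₀, …, X₈`, each of whose one-parameter groups is a `K`-conjugate of a compact
torus or of a boost `hypV p ()` (dimension count `dim_ℝ 𝔲(2,1) = 9`). Knapp 2002, I.§1 Example (3), VI.§2
(`𝔨 ⊕ 𝔭`). [folklore] -/
def u21AdaptedBasis : Module.Basis (Fin 9) ℝ ↥(uFormGroup (Fin 2) Unit).lie.toSubmodule :=
  Module.Basis.mk linearIndependent_u21GenMem span_u21GenMem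

/-- **`dim_ℝ 𝔲(2,1) = 9`.** Knapp 2002, I.§1 Example (3). [folklore] -/
theorem finrank_u21Lie : Module.finrank ℝ ↥(uFormGroup (Fin 2) Unit).lie.toSubmodule = 9 := by
  simpa using Module.finrank_eq_card_basis u21AdaptedBasis

/-- `u21AdaptedBasis i = X_i`. [folklore] -/
@[simp] theorem coe_u21AdaptedBasis (i : Fin 9) :
    ((u21AdaptedBasis i : ↥(uFormGroup (Fin 2) Unit).lie.toSubmodule) : Matrix (Fin 2 ⊕ Unit) (Fin 2 ⊕ Unit) ℂ) =
      u21Gen i := by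
  rw [u21AdaptedBasis, Module.Basis.mk_apply, coe_u21GenMem]

/-- the coordinates of `X ∈ 𝔲(2,1)` in the adapted basis are `u21Coeff X`. [folklore] -/
theorem u21AdaptedBasis_repr (X : ↥(uFormGroup (Fin 2) Unit).lie.toSubmodule) (i : Fin 9) :
    u21AdaptedBasis.repr X i = u21Coeff (X : Matrix (Fin 2 ⊕ Unit) (Fin 2 ⊕ Unit) ℂ) i := by
  have hsum : X = u21AdaptedBasis.equivFun.symm (u21Coeff (X : Matrix (Fin 2 ⊕ Unit) (Fin 2 ⊕ Unit) ℂ)) := by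
    rw [Module.Basis.equivFun_symm_apply]
    apply Subtype.ext
    rw [Submodule.coe_sum]
    simp only [Submodule.coe_smul, coe_u21AdaptedBasis, u21Gen_eq_explicit']
    exact eq_sum_u21Coeff_smul X.2
  rw [← Module.Basis.equivFun_apply]
  conv_lhs => rw [hsum]
  rw [LinearEquiv.apply_symm_apply]

/-- **The exponential table in `U(2,1)`** (conjugator / one-parameter-group form):
`expMem (s · u21AdaptedBasis i) = g_i L_i(s) g_i⁻¹`. [folklore] -/
theorem expMem_smul_u21AdaptedBasis' (i : Fin 9) (s : ℝ) :
    (uFormGroup (Fin 2) Unit).expMem (s • u21AdaptedBasis i) =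
      u21AdaptedConj i * u21AdaptedOneParam i s * (u21AdaptedConj i)⁻¹ := by
  apply Subtype.ext
  rw [RealMatrixGroup.coe_expMem]
  change expGL (s • ((u21AdaptedBasis i : ↥(uFormGroup (Fin 2) Unit).lie.toSubmodule) :
    Matrix (Fin 2 ⊕ Unit) (Fin 2 ⊕ Unit) ℂ)) = _
  rw [coe_u21AdaptedBasis, expGL_smul_u21Gen]

/-- **The exponential table in `U(2,1)`** — the shape consumed by `ArchimedeanSecondKindChart` (`ρ (expMem (s • B i))`), with
the frame and the letter read off the two index functions:
`expMem (s · u21AdaptedBasis i) = kV (u21FrameK i) * letterOf (u21Kind i) s * (kV (u21FrameK i))⁻¹`. [folklore] -/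
theorem expMem_smul_u21AdaptedBasis (i : Fin 9) (s : ℝ) :
    (uFormGroup (Fin 2) Unit).expMem (s • u21AdaptedBasis i) =
      kV (Fin 2) Unit (u21FrameK i) * letterOf (u21Kind i) s * (kV (Fin 2) Unit (u21FrameK i))⁻¹ :=
  expMem_smul_u21AdaptedBasis' i s

end Basis

end Literature.RepresentationTheory.KonnoKonno2007

end
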